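import Summits.KontsevichZagierPeriods.KontsevichZagierPeriods.Theses.MultivaluedCoV
import Summits.KontsevichZagierPeriods.KontsevichZagierPeriods.Theorems.MultivaluedCoVEllipticAreaIdentityHalfPlane
import Summits.KontsevichZagierPeriods.KontsevichZagierPeriods.Theorems.MultivaluedCoVEllipticAreaIdentityParam
import Summits.KontsevichZagierPeriods.KontsevichZagierPeriods.Theorems.MultivaluedCoVEllipticAreaIdentityCubic
import Summits.KontsevichZagierPeriods.KontsevichZagierPeriods.Theorems.MultivaluedCoVEllipticAreaIdentityJacobian
import Summits.KontsevichZagierPeriods.KontsevichZagierPeriods.Theorems.MultivaluedCoVEllipticAreaIdentityAlgebra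
import Summits.KontsevichZagierPeriods.KontsevichZagierPeriods.Theorems.UnfoldedStokesLegendreAllModuliStubStripNewtonLeibniz
import Summits.KontsevichZagierPeriods.KontsevichZagierPeriods.Theorems.SymplecticScissorsStackingShear
import Literature.NumberTheory.EllipticCurves.UniformizationProofs
import Literature.NumberTheory.EllipticCurves.UniformizationUniqueProofs
import Literature.NumberTheory.Transcendental.KZDominatedFamilyRelations
import Literature.NumberTheory.Transcendental.KZMonomialCompression
import HarnessLib

/-!
# The elliptic area identity `∬_{ℝ²} du dv/|P(u+iv)| = 2 ∫∫_R ds dt/√(−P(s)P(t))` in the KZ calculus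

Closing file for the support item `EllipticAreaIdentity` of route `MultivaluedCoV`
(`Summits/KontsevichZagierPeriods/KontsevichZagierPeriods/Theses/MultivaluedCoV.lean`):
for `g₂, g₃ ∈ ℚ` with `g₂³ − 27g₃² > 0` and `P(x) = 4x³ − g₂x − g₃` (three real roots
`e₃ < e₂ < e₁`), the formal combination `[ℝ², 1/|P(u+iv)|] − 2•[R, 1/√(−P(s)P(t))]`,
`R = (e₁, ∞) × (−∞, e₃)` (written with polynomial literals in the route file), lies in
`KZ.relations` — a CHAIN of moves of the Kontsevich–Zagier calculus (§1.2, rules 1 and 2):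

1. *Uniformisation.* `PeriodPair.uniformization_holds` / `uniformization_unique_holds` give a real
   rectangular lattice `Λ` with invariants `g₂, g₃` (`PeriodPair.isReal_of_g₂_g₃_real`,
   `PeriodPair.IsReal.half_sum_notMem_of_discr_pos`).
2. *The group law as ONE change of variables* (`of_sub_of_mem_changeOfVariablesRel`): with
   `a = ℘⁻¹` on the real and `c` on the imaginary half-period segment (file `…Param`),
   `Φ(s,t) = (re, im) ℘(a s − i c t)` is the route's algebraic addition-law map (file `…HalfPlane`,
   `weierstrassP_zeta_eq`), hence `ℚ`-semialgebraic (file `…Algebra`), injective with image exactly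
   the open upper half-plane `H` (file `…HalfPlane`), differentiable with
   `|det Φ'| = |P(Φ)|/√(−P(s)P(t))` (file `…Jacobian`): `[R, 1/√(−P(s)P(t))] − [H, 1/|P|]` is an
   instance of rule 2.
3. *Doubling* (`of_sub_two_nsmul_of_mem_relations`): `ℝ² = {v ≥ 0} ∪ {v ≤ 0}` (axis null, rule 1),
   the reflection `v ↦ −v` is a linear instance of rule 2 (`|P(ū)| = |P(u)|`,
   `KZ.of_sub_of_mem_changeOfVariablesRel_linear`), and `{v ≥ 0} ∖ H` is null
   (`KZ.IntegralRep.of_sub_of_restrict_mem_relations`): `[ℝ², 1/|P|] − 2•[H, 1/|P|] ∈ relations`.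

Value read-off: `∬_{ℝ²} du dv/|P| = 2 · (Ω₀/2) · (Ω₀'/2) = covol(Λ)/2` (Riemann's bilinear relation
for the rectangular lattice).

## References
* M. Kontsevich, D. Zagier, *Periods* (2001), §1.2.
* D. F. Lawden, *Elliptic Functions and Applications*, Springer 1989, §§6.8, 6.11–6.12.
* J. H. Silverman, *The Arithmetic of Elliptic Curves*, 2nd ed., VI.5.1, III.5.
-/

noncomputable section

open scoped ComplexConjugate Topology PeriodPair
open Complex Set Filter MeasureTheory MvPolynomial ContinuousLinearMap
open Literature.NumberTheory.Transcendental Literature.ModelTheory.ExponentialFields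

namespace Summit.KontsevichZagierPeriods.MultivaluedCoV.EllipticArea

open Summit.KontsevichZagierPeriods.UnfoldedStokes.LegendreAllModuliLine.M4
  (isSemialgebraic_pos1 isSemialgebraic_nonneg1)
open Summit.KontsevichZagierPeriods.SymplecticScissors.StackingShear
  (volume_setOf_apply_one_eq_zero)

/-! ### The closed lower half-plane

(The open and closed upper half-planes `{v > 0}`, `{v ≥ 0}` are `ℚ`-semialgebraic and the axis
`{v = 0}` is null: tree lemmas `UnfoldedStokes.LegendreAllModuliLine.M4.isSemialgebraic_pos1`,
`….isSemialgebraic_nonneg1`, `SymplecticScissors.StackingShear.volume_setOf_apply_one_eq_zero`.) -/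

/-- The closed lower half-plane `{v ≤ 0} ⊆ ℝ²` is `ℚ`-semialgebraic. -/
theorem isSemialgebraic_setOf_nonpos : IsSemialgebraic ℚ {w : Fin 2 → ℝ | w 1 ≤ 0} := by
  simpa using isSemialgebraic_setOf_eval_le (k := ℚ) (R := ℝ) (X 1 : MvPolynomial (Fin 2) ℚ) 0

/-! ### The reflection `(u, v) ↦ (u, −v)` -/

/-- The reflection is an involution. -/
theorem reflect_reflect (w : Fin 2 → ℝ) :
    (ContinuousLinearMap.pi ![proj 0, -proj 1] : (Fin 2 → ℝ) →L[ℝ] (Fin 2 → ℝ))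
      ((ContinuousLinearMap.pi ![proj 0, -proj 1] : (Fin 2 → ℝ) →L[ℝ] (Fin 2 → ℝ)) w) = w := by
  rw [reflect_apply, reflect_apply]
  ext i
  fin_cases i <;> simp

/-- The reflection maps the closed lower half-plane onto the closed upper half-plane. -/
theorem image_reflect_setOf_nonpos :
    (ContinuousLinearMap.pi ![proj 0, -proj 1] : (Fin 2 → ℝ) →L[ℝ] (Fin 2 → ℝ)) ''
        {w : Fin 2 → ℝ | w 1 ≤ 0} = {w : Fin 2 → ℝ | 0 ≤ w 1} := by
  ext w
  constructor
  · rintro ⟨x, hx, rfl⟩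
    simp only [mem_setOf_eq] at hx ⊢
    rw [reflect_apply]
    simpa using hx
  · intro hw
    refine ⟨(ContinuousLinearMap.pi ![proj 0, -proj 1] : (Fin 2 → ℝ) →L[ℝ] (Fin 2 → ℝ)) w, ?_,
      reflect_reflect w⟩
    simp only [mem_setOf_eq] at hw ⊢
    rw [reflect_apply]
    simpa using hw

/-- The reflection is a `ℚ`-semialgebraic map (a polynomial map `(X₀, −X₁)`). -/
theorem isSemialgebraicMapOn_reflect {σ : Set (Fin 2 → ℝ)} (hσ : IsSemialgebraic ℚ σ) :
    IsSemialgebraicMapOn ℚ σ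
      (ContinuousLinearMap.pi ![proj 0, -proj 1] : (Fin 2 → ℝ) →L[ℝ] (Fin 2 → ℝ)) := by
  refine (isSemialgebraicMapOn_aeval hσ ![X 0, -X 1]).congr fun w _ => ?_
  rw [reflect_apply]
  ext j
  fin_cases j <;> simp

/-! ### Doubling: `[ℝ², 1/|P|] − 2•[H, 1/|P|] ∈ relations` -/

/-- **Doubling by reflection.** For the full-plane representation `r = [ℝ², 1/|P(u+iv)|]`
(`P = 4x³ − g₂x − g₃`, `g₂, g₃ ∈ ℚ`) and its restriction `rH` to the open upper half-plane,
`[r] − 2•[rH] ∈ KZ.relations`: `ℝ² = {v ≥ 0} ∪ {v ≤ 0}` with null intersection (rule 1),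
`[{v ≤ 0}] − [{v ≥ 0}]` is the linear change of variables `v ↦ −v` (rule 2; `|P(ū)| = |P(u)|`,
`|det| = 1`), and `{v ≥ 0} ∖ {v > 0}` is null. -/
theorem of_sub_two_nsmul_of_mem_relations (g₂ g₃ : ℚ) (r rH : KZ.IntegralRep 2)
    (hr : r.domain = univ)
    (hri : EqOn r.integrand (fun w => 1 / ‖4 * ((w 0 : ℂ) + (w 1 : ℂ) * I) ^ 3 -
      (g₂ : ℂ) * ((w 0 : ℂ) + (w 1 : ℂ) * I) - (g₃ : ℂ)‖) r.domain)
    (hHd : rH.domain = {w | 0 < w 1}) (hHi : rH.integrand = r.integrand) :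
    KZ.of r - 2 • KZ.of rH ∈ KZ.relations := by
  set rup := r.restrict {w | 0 ≤ w 1} isSemialgebraic_nonneg1 (by rw [hr]; exact subset_univ _)
    with hrup
  set rlo := r.restrict {w | w 1 ≤ 0} isSemialgebraic_setOf_nonpos (by rw [hr]; exact subset_univ _)
    with hrlo
  -- (1) `ℝ² = {v ≥ 0} ∪ {v ≤ 0}`, rule 1
  have d1 : KZ.of r - KZ.of rup - KZ.of rlo ∈ KZ.domainAddRel := by
    refine ⟨2, r, rup, rlo, ?_, ?_, fun _ _ => rfl, fun _ _ => rfl, rfl⟩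
    · rw [hr]
      ext w
      simp only [mem_univ, true_iff, mem_union, hrup, hrlo, KZ.IntegralRep.domain_restrict,
        mem_setOf_eq]
      exact le_total 0 (w 1)
    · refine measure_mono_null (fun w hw => ?_) volume_setOf_apply_one_eq_zero
      simp only [hrup, hrlo, KZ.IntegralRep.domain_restrict, mem_inter_iff, mem_setOf_eq] at hw
      exact le_antisymm hw.2 hw.1
  -- (2) the reflection, rule 2
  have d2 : KZ.of rlo - KZ.of rup ∈ KZ.changeOfVariablesRel := by
    refine KZ.of_sub_of_mem_changeOfVariablesRel_linear rlo rup
      (ContinuousLinearMap.pi ![proj 0, -proj 1])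
      (isSemialgebraicMapOn_reflect rlo.isSemialgebraic_domain) ?_ ?_ ?_
    · intro x _ y _ hxy
      rw [← reflect_reflect x, ← reflect_reflect y]
      exact congrArg _ hxy
    · simp only [hrup, hrlo, KZ.IntegralRep.domain_restrict]
      exact image_reflect_setOf_nonpos.symm
    · intro x _
      simp only [hrup, hrlo, KZ.IntegralRep.integrand_restrict, det_reflect, abs_neg, abs_one,
        mul_one]
      rw [hri (by rw [hr]; exact mem_univ _), hri (by rw [hr]; exact mem_univ _), reflect_apply]
      have := norm_cubic_reflect g₂ g₃ (x 0) (x 1)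
      simp only [Matrix.cons_val_zero, Matrix.cons_val_one]
      push_cast at this ⊢
      rw [this]
  -- (3) `{v ≥ 0} ∖ {v > 0}` is null
  have hsub : {w : Fin 2 → ℝ | 0 < w 1} ⊆ rup.domain := fun w hw =>
    show 0 ≤ w 1 from le_of_lt (show 0 < w 1 from hw)
  have d3 : KZ.of rup - KZ.of (rup.restrict _ isSemialgebraic_pos1 hsub) ∈ KZ.relations := by
    refine rup.of_sub_of_restrict_mem_relations isSemialgebraic_pos1 hsub
      (measure_mono_null (fun w hw => ?_) volume_setOf_apply_one_eq_zero)
    simp only [hrup, KZ.IntegralRep.domain_restrict, Set.mem_sdiff, mem_setOf_eq, not_lt] at hw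
    exact le_antisymm hw.2 hw.1
  have d4 : KZ.of (rup.restrict _ isSemialgebraic_pos1 hsub) - KZ.of rH ∈ KZ.relations :=
    KZ.of_sub_of_mem_relations_of_eqOn (by rw [hHd]; rfl) (by rw [hHi]; exact fun _ _ => rfl)
  have : KZ.of r - 2 • KZ.of rH = (KZ.of r - KZ.of rup - KZ.of rlo) + (KZ.of rlo - KZ.of rup) +
      2 • ((KZ.of rup - KZ.of (rup.restrict _ isSemialgebraic_pos1 hsub)) +
        (KZ.of (rup.restrict _ isSemialgebraic_pos1 hsub) - KZ.of rH)) := by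
    abel
  rw [this]
  exact KZ.relations.add_mem
    (KZ.relations.add_mem (KZ.domainAddRel_subset_relations d1)
      (KZ.changeOfVariablesRel_subset_relations d2))
    (KZ.relations.nsmul_mem (KZ.relations.add_mem d3 d4) 2)


/-! ### The group law as one change of variables: `[R, 1/√(−P(s)P(t))] − [H, 1/|P|]` -/

variable {L : PeriodPair}

/-- **The addition law of `y² = P(x)` is one instance of rule 2.** Let `Λ` be a real rectangular
lattice with rational invariants `g₂, g₃`, `e₁ = ℘(Ω₀/2)`, `e₃ = ℘(iΩ₀'/2)`, and let `a`, `c` invert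
`℘` on the real and imaginary half-period segments (`℘(a s) = s`, `℘(i c t) = t`, with the
derivatives `a' = −1/√P`, `c' = 1/√(−P)`). For `r = [ℝ², 1/|P(u+iv)|]`,
`r' = [(e₁,∞) × (−∞,e₃), 1/√(−P(s)P(t))]` and `rH` the restriction of `r` to the open upper
half-plane, `[r'] − [rH] ∈ KZ.changeOfVariablesRel` along `Φ(s,t) = (re, im) ℘(a s − i c t)`:
`Φ` is the algebraic addition-law map (hence `ℚ`-semialgebraic), injective on `R` with image
exactly `{v > 0}`, differentiable, and `1/√(−P(s)P(t)) = |det Φ'|/|P(Φ)|` (Lawden §6.8, §6.11;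
Silverman AEC III.5). -/
theorem of_sub_of_mem_changeOfVariablesRel (h : L.IsReal)
    (hrect : ((L.minRealPeriod : ℂ) + I * (L.mulLeft I I_ne_zero).minRealPeriod) / 2 ∉ L.lattice)
    {g₂ g₃ : ℚ} (hA : L.g₂.re = g₂) (hB : L.g₃.re = g₃)
    {e₁ e₃ : ℝ} (he₁ : e₁ = L.weierstrassPRe (L.minRealPeriod / 2))
    (he₃ : e₃ = -(L.mulLeft I I_ne_zero).weierstrassPRe ((L.mulLeft I I_ne_zero).minRealPeriod / 2))
    {a c : ℝ → ℝ}
    (ha : ∀ x, e₁ < x → a x ∈ Ioo 0 (L.minRealPeriod / 2) ∧ ℘[L] (a x) = x ∧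
      ℘'[L] (a x) = -(Real.sqrt (4 * x ^ 3 - L.g₂.re * x - L.g₃.re) : ℝ))
    (ha2 : ∀ t ∈ Ioo 0 (L.minRealPeriod / 2), a ((℘[L] t).re) = t)
    (had : ∀ x, e₁ < x → HasDerivAt a (-(Real.sqrt (4 * x ^ 3 - L.g₂.re * x - L.g₃.re))⁻¹) x)
    (hc : ∀ t, t < e₃ → c t ∈ Ioo 0 ((L.mulLeft I I_ne_zero).minRealPeriod / 2) ∧
      ℘[L] (I * c t) = t ∧
      ℘'[L] (I * c t) = -I * (Real.sqrt (-(4 * t ^ 3 - L.g₂.re * t - L.g₃.re)) : ℝ))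
    (hc2 : ∀ u ∈ Ioo 0 ((L.mulLeft I I_ne_zero).minRealPeriod / 2), c ((℘[L] (I * u)).re) = u)
    (hcd : ∀ t, t < e₃ → HasDerivAt c (Real.sqrt (-(4 * t ^ 3 - L.g₂.re * t - L.g₃.re)))⁻¹ t)
    (r r' rH : KZ.IntegralRep 2) (hr : r.domain = univ)
    (hri : EqOn r.integrand (fun w => 1 / ‖4 * ((w 0 : ℂ) + (w 1 : ℂ) * I) ^ 3 -
      L.g₂ * ((w 0 : ℂ) + (w 1 : ℂ) * I) - L.g₃‖) r.domain)
    (hr' : r'.domain = {z | e₁ < z 0 ∧ z 1 < e₃})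
    (hr'i : EqOn r'.integrand (fun z => 1 / Real.sqrt (-((4 * z 0 ^ 3 - L.g₂.re * z 0 - L.g₃.re) *
      (4 * z 1 ^ 3 - L.g₂.re * z 1 - L.g₃.re)))) r'.domain)
    (hHd : rH.domain = {w | 0 < w 1}) (hHi : rH.integrand = r.integrand) :
    KZ.of r' - KZ.of rH ∈ KZ.changeOfVariablesRel := by
  refine ⟨2, r', rH,
    fun z => (ContinuousLinearMap.pi ![reCLM, imCLM] : ℂ →L[ℝ] (Fin 2 → ℝ))
      (℘[L] (((a (z 0) : ℝ) : ℂ) - I * ((c (z 1) : ℝ) : ℂ))),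
    fun z => (ContinuousLinearMap.pi ![reCLM, imCLM] : ℂ →L[ℝ] (Fin 2 → ℝ)).comp
      (℘'[L] (((a (z 0) : ℝ) : ℂ) - I * ((c (z 1) : ℝ) : ℂ)) •
        (ofRealCLM.comp ((-(Real.sqrt (4 * z 0 ^ 3 - L.g₂.re * z 0 - L.g₃.re))⁻¹) • proj 0) -
          I • ofRealCLM.comp
            ((Real.sqrt (-(4 * z 1 ^ 3 - L.g₂.re * z 1 - L.g₃.re)))⁻¹ • proj 1))),
    ?_, ?_, ?_, ?_, ?_, rfl⟩
  · -- `Φ` is the algebraic addition-law map on `R`, hence `ℚ`-semialgebraic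
    have hne : ∀ z ∈ r'.domain, z 0 ≠ z 1 := by
      intro z hz heq
      rw [hr'] at hz
      have h1 := h.cubic_pos_of_lt (x := z 0) (by rw [← he₁]; exact hz.1)
      have h2 := h.cubic_neg_of_lt (x := z 1) (by rw [← he₃]; exact hz.2)
      rw [heq] at h1
      linarith
    refine (isSemialgebraicMapOn_additionMap g₂ g₃ r'.isSemialgebraic_domain hne).congr
      fun z hz => ?_
    rw [hr'] at hz
    have hP := weierstrassP_zeta_eq h he₁ he₃ ha hc hz.1 hz.2
    simp only [reIm_apply, hP, add_re, ofReal_re, mul_re, I_re, mul_zero, ofReal_im, I_im,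
      mul_one, sub_self, add_zero, add_im, mul_im, zero_add, hA, hB]
  · -- derivative within `R` (chain rule, `…Jacobian`)
    intro z hz
    rw [hr'] at hz
    obtain ⟨hq0, hq1, -, -⟩ := zeta_mem_quarter ha hc hz.1 hz.2
    have hΛ := notMem_lattice_of_mem_quarter h hrect hq0 hq1
    exact (hasFDerivAt_phi (had (z 0) hz.1) (hcd (z 1) hz.2) hΛ).hasFDerivWithinAt
  · -- injective on `R`
    rw [hr']
    intro z hz z' hz' heq
    apply injOn_weierstrassP_zeta h hrect ha hc hz hz'
    have h0 := congr_fun heq 0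
    have h1 := congr_fun heq 1
    simp only [reIm_apply, Matrix.cons_val_zero, Matrix.cons_val_one] at h0 h1
    exact Complex.ext h0 h1
  · -- the image is exactly the open upper half-plane
    rw [hHd, hr']
    ext w
    constructor
    · intro hw
      obtain ⟨z, hz, hPz⟩ := exists_weierstrassP_zeta_eq h hrect he₁ he₃ ha ha2 hc hc2
        (w := (w 0 : ℂ) + (w 1 : ℂ) * I) (by simpa using hw)
      refine ⟨z, hz, ?_⟩
      simp only [hPz, reIm_apply]
      ext i
      fin_cases i <;> simp
    · rintro ⟨z, hz, rfl⟩
      simp only [mem_setOf_eq, reIm_apply, Matrix.cons_val_one]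
      exact weierstrassP_zeta_im_pos h he₁ he₃ ha hc hz.1 hz.2
  · -- the Jacobian identity (`…Jacobian`)
    intro z hz
    have hz' := hz
    rw [hr'] at hz'
    obtain ⟨hq0, hq1, -, -⟩ := zeta_mem_quarter ha hc hz'.1 hz'.2
    have hΛ := notMem_lattice_of_mem_quarter h hrect hq0 hq1
    have hder := derivWeierstrassP_ne_zero_of_mem_quarter h hrect hq0 hq1
    have hfs := h.cubic_pos_of_lt (x := z 0) (by rw [← he₁]; exact hz'.1)
    have hft := h.cubic_neg_of_lt (x := z 1) (by rw [← he₃]; exact hz'.2)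
    have hmem : (ContinuousLinearMap.pi ![reCLM, imCLM] : ℂ →L[ℝ] (Fin 2 → ℝ))
        (℘[L] (((a (z 0) : ℝ) : ℂ) - I * ((c (z 1) : ℝ) : ℂ))) ∈ r.domain := by
      rw [hr]; exact mem_univ _
    rw [hr'i hz, hHi, hri hmem]
    simp only [reIm_apply, Matrix.cons_val_zero, Matrix.cons_val_one, Complex.re_add_im]
    exact jacobian_identity hΛ hder hfs hft

/-! ### The closing theorem -/

/-- **The elliptic area identity** (support item `EllipticAreaIdentity` of route `MultivaluedCoV`):
for `g₂, g₃ ∈ ℚ` with `g₂³ − 27g₃² > 0`, `P = 4x³ − g₂x − g₃`,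
`[ℝ², 1/|P(u+iv)|] − 2•[R, 1/√(−P(s)P(t))] ∈ KZ.relations`, `R` the product of rays beyond the
largest and below the smallest real root
(`∬_{ℝ²} du dv/|P| = 2(∫_{e₁}^∞ ds/√P)(∫_{−∞}^{e₃} dt/√(−P))`).
Chain: uniformisation by a real rectangular lattice, the addition law as one change of variables
onto the upper half-plane (`of_sub_of_mem_changeOfVariablesRel`), and doubling by the reflection
`v ↦ −v` (`of_sub_two_nsmul_of_mem_relations`). -/
theorem ellipticAreaIdentity_proof :
    Summit.KontsevichZagierPeriods.KontsevichZagierPeriods.Theses.MultivaluedCoV.EllipticAreaIdentity :=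
    by
  intro g₂ g₃ hdisc r r' hr hri hr' hr'i
  -- a real rectangular lattice with invariants `g₂, g₃`
  have hD : (g₂ : ℂ) ^ 3 - 27 * (g₃ : ℂ) ^ 2 ≠ 0 := by
    have : ((g₂ ^ 3 - 27 * g₃ ^ 2 : ℚ) : ℂ) ≠ 0 := by exact_mod_cast hdisc.ne'
    push_cast at this
    exact this
  obtain ⟨L, hL2, hL3⟩ := PeriodPair.uniformization_holds _ _ hD
  have h : L.IsReal := PeriodPair.isReal_of_g₂_g₃_real PeriodPair.uniformization_unique_holds
    (by rw [hL2]; exact Complex.ratCast_im g₂) (by rw [hL3]; exact Complex.ratCast_im g₃)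
  have hA : L.g₂.re = g₂ := by rw [hL2]; exact Complex.ratCast_re g₂
  have hB : L.g₃.re = g₃ := by rw [hL3]; exact Complex.ratCast_re g₃
  have hdisc' : 0 < L.g₂.re ^ 3 - 27 * L.g₃.re ^ 2 := by
    rw [hA, hB]
    exact_mod_cast hdisc
  have hrect := h.half_sum_notMem_of_discr_pos hdisc'
  obtain ⟨a, ha, ha2, had⟩ := exists_inverse_weierstrassP_real h
  obtain ⟨c, hc, hc2, hcd⟩ := exists_inverse_weierstrassP_imag h
  -- the upper half-plane piece of `r`, and doubling
  set rH := r.restrict {w | 0 < w 1} isSemialgebraic_pos1 (by rw [hr]; exact subset_univ _)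
    with hrH
  have hdouble := of_sub_two_nsmul_of_mem_relations g₂ g₃ r rH hr hri rfl rfl
  -- the change of variables, in lattice coordinates
  rw [← hL2, ← hL3] at hri
  rw [← hA, ← hB, setOf_domain_eq h hdisc'] at hr'
  rw [← hA, ← hB] at hr'i
  have hcov := of_sub_of_mem_changeOfVariablesRel h hrect hA hB rfl rfl ha ha2 had hc hc2 hcd
    r r' rH hr hri hr' hr'i rfl rfl
  have : KZ.of r - 2 • KZ.of r' = (KZ.of r - 2 • KZ.of rH) - 2 • (KZ.of r' - KZ.of rH) := by abel
  rw [this]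
  exact KZ.relations.sub_mem hdouble
    (KZ.relations.nsmul_mem (KZ.changeOfVariablesRel_subset_relations hcov) 2)

end Summit.KontsevichZagierPeriods.MultivaluedCoV.EllipticArea

end
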